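import Literature.NumberTheory.Rogawski1990.ArchHCOrbitalFamilyG              -- ★ (LH3-p02): `orbFamG` (ED. 2: zero-extended off admissible labels), `chartOrbG_def`
import Literature.NumberTheory.Rogawski1990.ArchTransfFamilyWeyl              -- ★ p849820 (LH7-p02): `archRG_negXAt` (+ ★ `…Symmetries`: `gprimeTorus_add_angleShift`, `archRG_add_angleShift`; ★ `ArchHCSpaceG`)
import Literature.NumberTheory.Automorphic.ArchInnerFormChartOrbWeyl           -- ★ p849884 (LH3-p02) (W-real-G′): `chartOrbG_negXAt`
import Literature.NumberTheory.Rogawski1990.ArchEndoscopicEigenvalueCompact   -- ★ p848061 (LH3-p03): `exists_forall_isRoot_charpoly_norm_le_of_isCompact` (Cauchy's bound on a compact family)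
import Literature.NumberTheory.Automorphic.ArchInnerFormCartanAtlasRegular    -- ★ (LH3-p03): `charpoly_map_evalC_gprimeTorus`
import HarnessLib

/-!
# Two of the five conjuncts of the letter O-L1 «`orbFamG ν′ a′ ∈ ArchHCSpaceG`», UNCONDITIONALLY: (P) periodicity and (I₄) bounded split support of the genuine
# `R′`-normalised orbital family on the `G′`-atlas (Bouaziz 1994 §3.1 (I₄) p. 579; Shelstad 1979 §4 p. 22; Rogawski 1990 §4.3 p. 42)

Topic `NumberTheory/Rogawski1990`; namespace `Literature.NumberTheory.Rogawski1990`.  THEOREMS ONLY (no definition, no instance, no notation, no axiom, no named fact, no `sorry`).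
Cell `pub/hodgecm-mathlib`, crux H413 (`stmt-HodgeConjecture-24833`), F0∕P3c line LH3 (closer stub `stub_N9`, DIRECT ROAD): organ (L1-PW) of LH3-plan (g2)'s skeleton v1
`F0_P3c_StubN9Direct` (letter L1 `HcOrbitalFamiliesStatement : ∃ jc′ ∀ a′, ArchHCSpaceG (slotSign L α) jc′ (orbFamG L α ν′ a′)` = (P) ∧ (W) ∧ (I₁)+one-sided ∧ (I₄) ∧ (I₃));
LH3-p02 (g2).  This file discharges (P) and (I₄) in-house for EVERY compactly supported `a′`; (W), (I₁), (I₃) are Harish-Chandra's (letter ∕ later organs).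

* §1 **`archHcPeriodic_orbFamG (a′) : ArchHcPeriodic (orbFamG L α ν′ a′)`** — for EVERY `a′`: the angle lattice lies in the kernel of the chart homomorphism (★
  `gprimeTorus_add_angleShift`), `chartOrbG` reads `c` only through the chart point (★ `chartOrbG_congr`), `R′` is periodic (★ `archRG_add_angleShift`); junk labels are `0`.
* §2 `charpoly_map_evalC_conj` (conjugation in `G′_∞` fixes every place-`w` characteristic polynomial), `isRoot_charpoly_map_evalC_gprimeTorus` (at a split place of an
  admissible chart `boostEig (c w) i`, in particular `e^{±x_w+iθ_w}`, are eigenvalues; moduli `e^{±x}`),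
  **`exists_forall_conj_gprimeTorus_not_mem_of_isCompact (hK : IsCompact K) : ∃ R, ∀ S′ admissible, ∀ c, (∃ w ∈ S′, R < |c w 0|) → ∀ y, y · gprimeTorus α S′ c · y⁻¹ ∉ K`**
  (the eigenvalue of modulus `e^{|x_w|} > |x_w| > R` survives conjugation; the place-`w` eigenvalues over the compact `K` are bounded by `R` — ★
  `exists_forall_isRoot_charpoly_norm_le_of_isCompact`), and **`archHcCompactSupport_orbFamG (hc′ : HasCompactSupport a′) : ArchHcCompactSupport (orbFamG L α ν′ a′)`** — beyond
  that bound for `K = tsupport a′` the orbital integrand vanishes identically, so `chartOrbG = dt′(B′) · 0` and `orbFamG S′ c = 0` (Bouaziz (I₄) «à support compact modulo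
  conjugaison» for the genuine family).
* §3 (ED. 2) **`orbFamG_negXAt (hα) (a′) (S′) (c) (hw : w ∈ S′)`** and `archHcWeyl_orbFamG_split` — the SPLIT half of (W) for the genuine family (★ `archRG_negXAt`, LH7-p02,
  + ★ `chartOrbG_negXAt`, (W-real-G′)).
* §4 (ED. 3) `orbFamG_hcSwapAt_mul_archRG` (compact same-sign swaps, ★ `chartOrbG_swap` over ★ (SWAP-CONJ)) and **`archHcWeyl_orbFamG (hα) (hreal) (a′) :
  ArchHcWeyl (slotSign L α) (orbFamG L α ν′ a′)`** — (W) IN FULL for the genuine family.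
* §5 (ED. 4) **`archHCSpaceG_orbFamG_iff`** ∕ `archHCSpaceG_orbFamG` — membership of the genuine family in `ArchHCSpaceG (slotSign L α) jc′` ⟺ its two Harish-Chandra clauses
  ((I₁)+one-sided, (I₃)): the honest residue of the letter L1.
HONEST LABEL: HC_CM is proved only modulo the 7 printed citations (2 remaining: hLiu418 = `stmt-HodgeConjecture-24832`, h413 = `stmt-HodgeConjecture-24833`) until rung 0 closes;
count-neutral (ED. 3∕4: three of the five clauses — (P), (W), (I₄) — for the genuine family, and the reduction of L1 to the other two).

## References
* [Bouaziz1994IntegralesOrbitales] A. Bouaziz, *Intégrales orbitales sur les groupes de Lie réductifs*, Ann. Sci. ÉNS 27 (1994), §3.1 (I₁)–(I₄) p. 579.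
* [Shelstad1979] D. Shelstad, *Characters and inner forms of a quasi-split group over ℝ*, Compositio Math. 39 (1979), §4 p. 22 (`Ψ^T_f`, `T^I_reg`).
* [Rogawski1990] J. D. Rogawski, *Automorphic Representations of Unitary Groups in Three Variables*, Ann. of Math. Stud. 123 (1990), §3.1 p. 19, §4.3 p. 42.
* [Knapp1986] A. W. Knapp, *Representation Theory of Semisimple Groups* (1986), Ch. V §3 (Cartan subgroups of `SU(2,1)`: the boost eigenvalues `e^{±x+iθ}`).
* [HornJohnson2013] R. A. Horn, C. R. Johnson, *Matrix Analysis*, 2nd ed. (2013), Thm 1.2.16, §5.6 (Cauchy's root bound).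
-/

set_option autoImplicit false

noncomputable section

open MeasureTheory MeasureTheory.Measure NumberField NumberField.InfinitePlace Matrix Complex Topology
open Literature.MeasureTheory.Group
open scoped MatrixGroups Matrix Classical NNReal ENNReal


namespace Literature.NumberTheory.Rogawski1990

open Literature.NumberTheory.Automorphic Literature.NumberTheory.Automorphic.UnitaryGroup Literature.NumberTheory.Automorphic.ArchCartan Polynomial

section Clauses

variable (L : Type) [Field L] [NumberField L] [IsCMField L] (α : Fin 3 → L)
  [MeasurableSpace ↥(arch (↥(maximalRealSubfield L)) L (IsCMField.complexConj L) 3 (Matrix.diagonal α))] [BorelSpace ↥(arch (↥(maximalRealSubfield L)) L (IsCMField.complexConj L) 3 (Matrix.diagonal α))]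
  (ν' : Measure ↥(arch (↥(maximalRealSubfield L)) L (IsCMField.complexConj L) 3 (Matrix.diagonal α))) [IsFiniteMeasureOnCompacts ν'] [ν'.IsMulRightInvariant]

/-- **(P) FOR THE GENUINE FAMILY — `orbFamG ν′ a′` is `2π`-periodic in every angle slot, for EVERY `a′`**: the chart point is (★ `gprimeTorus_add_angleShift`, LH7-p02: the angle
lattice lies in the kernel of the chart homomorphism), `chartOrbG` depends on `c` only through the chart point (★ `chartOrbG_congr`), and `R′` is periodic (★ `archRG_add_angleShift`);
on a junk label both sides are `0`. [cite: Shelstad1979, §4 p. 22] [cite: Bouaziz1994IntegralesOrbitales, §3.1 p. 579] -/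
theorem archHcPeriodic_orbFamG (a' : ↥(arch (↥(maximalRealSubfield L)) L (IsCMField.complexConj L) 3 (Matrix.diagonal α)) → ℂ) : ArchHcPeriodic (orbFamG L α ν' a') := by
  intro S' c w i k h
  by_cases hS' : ∀ v, v ∈ S' → v ∈ splitChartPlaces L α
  · rw [orbFamG_apply L α ν' a' hS', orbFamG_apply L α ν' a' hS', archRG_add_angleShift S' c h k,
      chartOrbG_congr L α ν' S' a' (gprimeTorus_add_angleShift L α S' c h k)]
  · rw [orbFamG_of_not L α ν' a' hS']

omit [MeasurableSpace ↥(arch (↥(maximalRealSubfield L)) L (IsCMField.complexConj L) 3 (Matrix.diagonal α))] [BorelSpace ↥(arch (↥(maximalRealSubfield L)) L (IsCMField.complexConj L) 3 (Matrix.diagonal α))] in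
/-- **Conjugation does not change the place-`w` characteristic polynomial** (`(y γ y⁻¹)_w = y_w γ_w y_w⁻¹` in `GL₃(ℂ)`; Mathlib `Matrix.charpoly_units_conj`).
[cite: Rogawski1990, §3.1 p. 19] -/
theorem charpoly_map_evalC_conj (γ y : ↥(arch (↥(maximalRealSubfield L)) L (IsCMField.complexConj L) 3 (Matrix.diagonal α))) (w : {w : InfinitePlace L // IsComplex w}) :
    ((((y * γ * y⁻¹ : ↥(arch (↥(maximalRealSubfield L)) L (IsCMField.complexConj L) 3 (Matrix.diagonal α))) : GL (Fin 3) (mixedEmbedding.mixedSpace L)) : Matrix (Fin 3) (Fin 3) (mixedEmbedding.mixedSpace L)).map (evalC L w)).charpoly =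
      ((((γ : ↥(arch (↥(maximalRealSubfield L)) L (IsCMField.complexConj L) 3 (Matrix.diagonal α))) : GL (Fin 3) (mixedEmbedding.mixedSpace L)) : Matrix (Fin 3) (Fin 3) (mixedEmbedding.mixedSpace L)).map (evalC L w)).charpoly := by
  change (((Matrix.GeneralLinearGroup.map (evalC L w) ((y * γ * y⁻¹ : ↥(arch (↥(maximalRealSubfield L)) L (IsCMField.complexConj L) 3 (Matrix.diagonal α))) : GL (Fin 3) (mixedEmbedding.mixedSpace L)) : GL (Fin 3) ℂ) :
      Matrix (Fin 3) (Fin 3) ℂ)).charpoly =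
    (((Matrix.GeneralLinearGroup.map (evalC L w) ((γ : ↥(arch (↥(maximalRealSubfield L)) L (IsCMField.complexConj L) 3 (Matrix.diagonal α))) : GL (Fin 3) (mixedEmbedding.mixedSpace L)) : GL (Fin 3) ℂ) : Matrix (Fin 3) (Fin 3) ℂ)).charpoly
  have hval : ((y * γ * y⁻¹ : ↥(arch (↥(maximalRealSubfield L)) L (IsCMField.complexConj L) 3 (Matrix.diagonal α))) : GL (Fin 3) (mixedEmbedding.mixedSpace L)) =
      (y : GL (Fin 3) (mixedEmbedding.mixedSpace L)) * (γ : GL (Fin 3) (mixedEmbedding.mixedSpace L)) * (y : GL (Fin 3) (mixedEmbedding.mixedSpace L))⁻¹ := rfl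
  have e1 : Matrix.GeneralLinearGroup.map (evalC L w) ((y * γ * y⁻¹ : ↥(arch (↥(maximalRealSubfield L)) L (IsCMField.complexConj L) 3 (Matrix.diagonal α))) : GL (Fin 3) (mixedEmbedding.mixedSpace L)) =
      Matrix.GeneralLinearGroup.map (evalC L w) (y : GL (Fin 3) (mixedEmbedding.mixedSpace L)) *
        Matrix.GeneralLinearGroup.map (evalC L w) (γ : GL (Fin 3) (mixedEmbedding.mixedSpace L)) *
        (Matrix.GeneralLinearGroup.map (evalC L w) (y : GL (Fin 3) (mixedEmbedding.mixedSpace L)))⁻¹ := by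
    rw [hval, MonoidHom.map_mul, MonoidHom.map_mul, MonoidHom.map_inv]
  have e2 := Matrix.charpoly_units_conj (Matrix.GeneralLinearGroup.map (evalC L w) (y : GL (Fin 3) (mixedEmbedding.mixedSpace L)))
    ((Matrix.GeneralLinearGroup.map (evalC L w) (γ : GL (Fin 3) (mixedEmbedding.mixedSpace L)) : GL (Fin 3) ℂ) : Matrix (Fin 3) (Fin 3) ℂ)
  refine Eq.trans ?_ e2
  exact congrArg Matrix.charpoly (by rw [e1, Units.val_mul, Units.val_mul, Matrix.coe_units_inv])

omit [MeasurableSpace ↥(arch (↥(maximalRealSubfield L)) L (IsCMField.complexConj L) 3 (Matrix.diagonal α))] [BorelSpace ↥(arch (↥(maximalRealSubfield L)) L (IsCMField.complexConj L) 3 (Matrix.diagonal α))] in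
/-- **At a split place of an admissible chart the pair `e^{±x_w + iθ_w}` are eigenvalues of the chart point** (★ `charpoly_map_evalC_gprimeTorus`: the place-`w` characteristic
polynomial is `∏_i (X − boostEig (c w) i)`). [cite: Rogawski1990, §4.3 p. 42] [cite: Knapp1986, Ch. V §3] -/
theorem isRoot_charpoly_map_evalC_gprimeTorus {S' : Finset {w : InfinitePlace L // IsComplex w}} (hS' : ∀ w, w ∈ S' → w ∈ splitChartPlaces L α) (c : {w : InfinitePlace L // IsComplex w} → Fin 3 → ℝ) {w : {w : InfinitePlace L // IsComplex w}} (hw : w ∈ S')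
    (i : Fin 3) :
    ((((gprimeTorus L α S' c : ↥(arch (↥(maximalRealSubfield L)) L (IsCMField.complexConj L) 3 (Matrix.diagonal α))) : GL (Fin 3) (mixedEmbedding.mixedSpace L)) : Matrix (Fin 3) (Fin 3) (mixedEmbedding.mixedSpace L)).map (evalC L w)).charpoly.IsRoot
      (boostEig (c w) i) := by
  rw [charpoly_map_evalC_gprimeTorus L α S' c hS' w, if_pos hw, Polynomial.IsRoot.def, Polynomial.eval_prod, Finset.prod_eq_zero_iff]
  exact ⟨i, Finset.mem_univ i, by rw [eval_sub, eval_X, eval_C, sub_self]⟩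

omit [MeasurableSpace ↥(arch (↥(maximalRealSubfield L)) L (IsCMField.complexConj L) 3 (Matrix.diagonal α))] [BorelSpace ↥(arch (↥(maximalRealSubfield L)) L (IsCMField.complexConj L) 3 (Matrix.diagonal α))] in
/-- The two hyperbolic eigenvalues have moduli `e^{x}` and `e^{−x}` (local copy; ★ `ArchExplicitTransferFactorAtlas` has the public one). [cite: Knapp1986, Ch. V §3] -/
private theorem norm_boostEig_zero' (c : Fin 3 → ℝ) : ‖boostEig c 0‖ = Real.exp (c 0) := by
  simp [boostEig, Complex.norm_exp]

omit [MeasurableSpace ↥(arch (↥(maximalRealSubfield L)) L (IsCMField.complexConj L) 3 (Matrix.diagonal α))] [BorelSpace ↥(arch (↥(maximalRealSubfield L)) L (IsCMField.complexConj L) 3 (Matrix.diagonal α))] in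
/-- The two hyperbolic eigenvalues have moduli `e^{x}` and `e^{−x}` (local copy). [cite: Knapp1986, Ch. V §3] -/
private theorem norm_boostEig_two' (c : Fin 3 → ℝ) : ‖boostEig c 2‖ = Real.exp (-c 0) := by
  simp [boostEig, Complex.norm_exp]

omit [MeasurableSpace ↥(arch (↥(maximalRealSubfield L)) L (IsCMField.complexConj L) 3 (Matrix.diagonal α))] [BorelSpace ↥(arch (↥(maximalRealSubfield L)) L (IsCMField.complexConj L) 3 (Matrix.diagonal α))] in
/-- **NO CONJUGATE OF A FAR-OUT SPLIT CHART POINT MEETS A COMPACT SET.**  For a compact `K ⊆ G′_∞` there is `R` such that for every admissible label `S′`, every `c` with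
`R < |x_w|` at some `w ∈ S′`, and every `y`: `y · gprimeTorus α S′ c · y⁻¹ ∉ K` (the eigenvalue `e^{±x_w+iθ_w}` of modulus `e^{|x_w|} > |x_w| > R` survives conjugation, while the
place-`w` eigenvalues of the points of `K` are bounded by `R` — ★ `exists_forall_isRoot_charpoly_norm_le_of_isCompact`, Cauchy's bound on a compact family).
[cite: Rogawski1990, §4.3 p. 42] [cite: HornJohnson2013, Thm 1.2.16] -/
theorem exists_forall_conj_gprimeTorus_not_mem_of_isCompact {K : Set ↥(arch (↥(maximalRealSubfield L)) L (IsCMField.complexConj L) 3 (Matrix.diagonal α))} (hK : IsCompact K) :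
    ∃ R : ℝ, ∀ (S' : Finset {w : InfinitePlace L // IsComplex w}), (∀ w, w ∈ S' → w ∈ splitChartPlaces L α) → ∀ (c : {w : InfinitePlace L // IsComplex w} → Fin 3 → ℝ), (∃ w ∈ S', R < |c w 0|) →
      ∀ y : ↥(arch (↥(maximalRealSubfield L)) L (IsCMField.complexConj L) 3 (Matrix.diagonal α)), y * gprimeTorus L α S' c * y⁻¹ ∉ K := by
  classical
  -- one Cauchy bound per place, then the maximum over the finitely many places
  have hf : ∀ w : {w : InfinitePlace L // IsComplex w}, Continuous fun g : ↥(arch (↥(maximalRealSubfield L)) L (IsCMField.complexConj L) 3 (Matrix.diagonal α)) =>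
      (((g : GL (Fin 3) (mixedEmbedding.mixedSpace L)) : Matrix (Fin 3) (Fin 3) (mixedEmbedding.mixedSpace L)).map (evalC L w)) := fun w =>
    (Units.continuous_val.matrix_map (UnitaryGroup.continuous_evalC L w)).comp continuous_subtype_val
  choose Rw hRw using fun w : {w : InfinitePlace L // IsComplex w} => exists_forall_isRoot_charpoly_norm_le_of_isCompact hK (hf w)
  refine ⟨∑ w, |Rw w|, fun S' hS' c ⟨w, hw, hx⟩ y hy => ?_⟩
  -- the surviving eigenvalue of modulus `e^{|x_w|}`
  have hRle : Rw w ≤ ∑ v, |Rw v| := (le_abs_self _).trans (Finset.single_le_sum (f := fun v => |Rw v|) (fun _ _ => abs_nonneg _) (Finset.mem_univ w))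
  have hroot : ∀ i : Fin 3, ‖boostEig (c w) i‖ ≤ Rw w := fun i => by
    refine hRw w _ hy _ ?_
    rw [charpoly_map_evalC_conj]
    exact isRoot_charpoly_map_evalC_gprimeTorus L α hS' c hw i
  have hexp : Real.exp |c w 0| ≤ Rw w := by
    rcases le_or_gt 0 (c w 0) with h0 | h0
    · rw [abs_of_nonneg h0, ← norm_boostEig_zero']; exact hroot 0
    · rw [abs_of_neg h0, ← norm_boostEig_two']; exact hroot 2
  have hlt : |c w 0| < Real.exp |c w 0| := by linarith [Real.add_one_le_exp |c w 0|]
  linarith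

/-- **(I₄) FOR THE GENUINE FAMILY — `orbFamG ν′ a′` HAS BOUNDED SPLIT SUPPORT for every compactly supported `a′`**: beyond the bound of
`exists_forall_conj_gprimeTorus_not_mem_of_isCompact` for `K = tsupport a′` the orbital integrand `y ↦ a′ (y · gprimeTorus α S′ c · y⁻¹)` vanishes identically, so
`chartOrbG = dt′(B′) · 0 = 0` and `orbFamG S′ c = 0`; junk labels are `0` outright.  One of the five conjuncts of the letter O-L1, unconditional.
[cite: Bouaziz1994IntegralesOrbitales, §3.1 (I₄) p. 579] [cite: Shelstad1979, §4 p. 22] [cite: Rogawski1990, §4.3 p. 42] -/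
theorem archHcCompactSupport_orbFamG {a' : ↥(arch (↥(maximalRealSubfield L)) L (IsCMField.complexConj L) 3 (Matrix.diagonal α)) → ℂ} (hc' : HasCompactSupport a') : ArchHcCompactSupport (orbFamG L α ν' a') := by
  obtain ⟨R, hR⟩ := exists_forall_conj_gprimeTorus_not_mem_of_isCompact L α hc'
  intro S'
  refine ⟨R, fun c hc => ?_⟩
  by_cases hS' : ∀ w, w ∈ S' → w ∈ splitChartPlaces L α
  · rw [orbFamG_apply L α ν' a' hS', chartOrbG_def]
    letI : MeasurableSpace (↥(arch (↥(maximalRealSubfield L)) L (IsCMField.complexConj L) 3 (Matrix.diagonal α)) ⧸ chartTorusG L α S') := borel _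
    have hzero : descConj (gprimeTorus L α S' c) (chartTorusG L α S') (forall_mem_chartTorusG_comm L α S' c) a' = fun _ => 0 := by
      funext y
      induction y using QuotientGroup.induction_on with
      | H g =>
        rw [descConj_mk]
        exact image_eq_zero_of_notMem_tsupport (hR S' hS' c hc g)
    rw [hzero, integral_zero, mul_zero, mul_zero]
  · rw [orbFamG_of_not L α ν' a' hS']

end Clauses

/-! ## §3 (ED. 2) The split half of (W): the genuine family is EVEN in `x_w` -/

section WeylSplit

variable (L : Type) [Field L] [NumberField L] [IsCMField L] (α : Fin 3 → L)
  [MeasurableSpace ↥(arch (↥(maximalRealSubfield L)) L (IsCMField.complexConj L) 3 (Matrix.diagonal α))] [BorelSpace ↥(arch (↥(maximalRealSubfield L)) L (IsCMField.complexConj L) 3 (Matrix.diagonal α))]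
  (ν' : Measure ↥(arch (↥(maximalRealSubfield L)) L (IsCMField.complexConj L) 3 (Matrix.diagonal α))) [ν'.IsHaarMeasure] [ν'.IsMulRightInvariant]

/-- **THE SPLIT HALF OF (W) FOR THE GENUINE FAMILY**: `orbFamG ν′ a′ S′ (negXAt w c) = orbFamG ν′ a′ S′ c` for `w ∈ S′`, EVERY `c`, every `a′` (`α_i ≠ 0`, Haar `ν′`) — on an
admissible label `R′` is even (★ `archRG_negXAt`) and `chartOrbG` is even (★ `chartOrbG_negXAt`: the realised real reflection of `U(2,1)` is conjugation by an involution
normalising the chart torus); on a junk label both sides are `0`.  This is the second conjunct of ★ `ArchHcWeyl s (orbFamG …)`; the first (compact same-sign swaps) awaits the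
realised-swap conjugacy of the atlas. [cite: Shelstad1979, §4 p. 23] [cite: Bouaziz1994IntegralesOrbitales, §3.1 p. 579] -/
theorem orbFamG_negXAt (hα : ∀ i, α i ≠ 0) (a' : ↥(arch (↥(maximalRealSubfield L)) L (IsCMField.complexConj L) 3 (Matrix.diagonal α)) → ℂ) (S' : Finset {w : InfinitePlace L // IsComplex w}) (c : {w : InfinitePlace L // IsComplex w} → Fin 3 → ℝ) {w : {w : InfinitePlace L // IsComplex w}} (hw : w ∈ S') :
    orbFamG L α ν' a' S' (negXAt w c) = orbFamG L α ν' a' S' c := by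
  by_cases hS' : ∀ v, v ∈ S' → v ∈ splitChartPlaces L α
  · rw [orbFamG_apply L α ν' a' hS', orbFamG_apply L α ν' a' hS', archRG_negXAt S' hw c, chartOrbG_negXAt L α ν' S' hα hS' hw a' c]
  · rw [orbFamG_of_not L α ν' a' hS']

/-- The split conjunct of ★ `ArchHcWeyl` for the genuine family, in the clause's exact shape. [cite: Shelstad1979, §4 p. 23] -/
theorem archHcWeyl_orbFamG_split (hα : ∀ i, α i ≠ 0) (a' : ↥(arch (↥(maximalRealSubfield L)) L (IsCMField.complexConj L) 3 (Matrix.diagonal α)) → ℂ) :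
    ∀ (S' : Finset {w : InfinitePlace L // IsComplex w}) (c : {w : InfinitePlace L // IsComplex w} → Fin 3 → ℝ) (w : {w : InfinitePlace L // IsComplex w}), w ∈ S' → orbFamG L α ν' a' S' (negXAt w c) = orbFamG L α ν' a' S' c :=
  fun S' c _ hw => orbFamG_negXAt L α ν' hα a' S' c hw

end WeylSplit

/-! ## §4 (ED. 3) The full Weyl clause (W) for the genuine family -/

section WeylFull

variable (L : Type) [Field L] [NumberField L] [IsCMField L] (α : Fin 3 → L)
  [MeasurableSpace ↥(arch (↥(maximalRealSubfield L)) L (IsCMField.complexConj L) 3 (Matrix.diagonal α))] [BorelSpace ↥(arch (↥(maximalRealSubfield L)) L (IsCMField.complexConj L) 3 (Matrix.diagonal α))]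
  (ν' : Measure ↥(arch (↥(maximalRealSubfield L)) L (IsCMField.complexConj L) 3 (Matrix.diagonal α))) [ν'.IsHaarMeasure] [ν'.IsMulRightInvariant]

/-- **The compact-swap half**: at `w ∉ S′` and two slots of the SAME adapted sign (`slotSign L α w i = slotSign L α w j` — a compact, REALISED reflection), the `R′`-twisted symmetry
`F S′ (swap c) · R′(c) = R′(swap c) · F S′ c` holds for `F = orbFamG ν′ a′` and EVERY `c` (admissible label: `F = R′ · chartOrbG` and ★ `chartOrbG_swap`; junk label: `0 = 0`).  `α` real at
every complex place (`hreal`, the house frame `α_i ∈ L⁺`). [cite: Shelstad1979, §4 p. 23] [cite: Bouaziz1994IntegralesOrbitales, §3.1 p. 579] -/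
theorem orbFamG_hcSwapAt_mul_archRG (hα : ∀ i, α i ≠ 0) (hreal : ∀ (w : {w : InfinitePlace L // IsComplex w}) (k : Fin 3), (w.1.embedding (α k)).im = 0) (a' : ↥(arch (↥(maximalRealSubfield L)) L (IsCMField.complexConj L) 3 (Matrix.diagonal α)) → ℂ)
    (S' : Finset {w : InfinitePlace L // IsComplex w}) (c : {w : InfinitePlace L // IsComplex w} → Fin 3 → ℝ) {w : {w : InfinitePlace L // IsComplex w}} {i j : Fin 3} (hw : w ∉ S') (hs : slotSign L α w i = slotSign L α w j) :
    orbFamG L α ν' a' S' (hcSwapAt w i j c) * archRG S' c = archRG S' (hcSwapAt w i j c) * orbFamG L α ν' a' S' c := by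
  by_cases hS' : ∀ v, v ∈ S' → v ∈ splitChartPlaces L α
  · have hsw : chartOrbG L α ν' S' a' (hcSwapAt w i j c) = chartOrbG L α ν' S' a' c :=
      chartOrbG_swap L α ν' S' hα hS' (hreal w) hw i j (by rw [← slotSign_apply, ← slotSign_apply]; exact hs) a' c
    rw [orbFamG_apply L α ν' a' hS', orbFamG_apply L α ν' a' hS', hsw]
    ring
  · rw [orbFamG_of_not L α ν' a' hS', zero_mul, mul_zero]

/-- **(W) FOR THE GENUINE FAMILY — `ArchHcWeyl (slotSign L α) (orbFamG L α ν′ a′)`** for every `a′`, every Haar `ν′` (`α_i ≠ 0`, `α` real at the complex places): symmetry under the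
REALISED Weyl group of every chart — the same-sign compact swaps (★ `chartOrbG_swap` over ★ (SWAP-CONJ), LH4-p01) and the split reflections `x_w ↦ −x_w` (★ `orbFamG_negXAt`).  With ★
`archHcPeriodic_orbFamG` and ★ `archHcCompactSupport_orbFamG`, THREE of the five conjuncts of the letter L1 `HcOrbitalFamiliesStatement` are in-house; (I₁)+one-sided and (I₃) remain
Harish-Chandra's. [cite: Shelstad1979, §4 p. 23; Thm. 4.7 (II) p. 31] [cite: Bouaziz1994IntegralesOrbitales, §3.1–3.2 pp. 579–580] -/
theorem archHcWeyl_orbFamG (hα : ∀ i, α i ≠ 0) (hreal : ∀ (w : {w : InfinitePlace L // IsComplex w}) (k : Fin 3), (w.1.embedding (α k)).im = 0) (a' : ↥(arch (↥(maximalRealSubfield L)) L (IsCMField.complexConj L) 3 (Matrix.diagonal α)) → ℂ) :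
    ArchHcWeyl (slotSign L α) (orbFamG L α ν' a') :=
  ⟨fun S' c _ _ _ hw _ hs => orbFamG_hcSwapAt_mul_archRG L α ν' hα hreal a' S' c hw hs, archHcWeyl_orbFamG_split L α ν' hα a'⟩

end WeylFull

/-! ## §5 (ED. 4) The in-house share of the letter L1: `ArchHCSpaceG` for the genuine family REDUCES to Harish-Chandra's two analytic clauses -/

section Residue

variable (L : Type) [Field L] [NumberField L] [IsCMField L] (α : Fin 3 → L)
  [MeasurableSpace ↥(arch (↥(maximalRealSubfield L)) L (IsCMField.complexConj L) 3 (Matrix.diagonal α))] [BorelSpace ↥(arch (↥(maximalRealSubfield L)) L (IsCMField.complexConj L) 3 (Matrix.diagonal α))]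
  (ν' : Measure ↥(arch (↥(maximalRealSubfield L)) L (IsCMField.complexConj L) 3 (Matrix.diagonal α))) [ν'.IsHaarMeasure] [ν'.IsMulRightInvariant]

/-- **`orbFamG ν′ a′ ∈ ArchHCSpaceG (slotSign L α) jc′` IFF ITS TWO HARISH-CHANDRA CLAUSES HOLD** — (P), (W), (I₄) being theorems for the genuine family (★ `archHcPeriodic_orbFamG`,
★ `archHcWeyl_orbFamG`, ★ `archHcCompactSupport_orbFamG`), the letter L1 `HcOrbitalFamiliesStatement` of the direct-road skeleton is EQUIVALENT to its honest analytic residue: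
(I₁)+one-sided structure `ArchHcSmoothOneSided` and the jump relations (I₃) `ArchHcJump` [Varadarajan1977, I §1.12; Bouaziz 1994 §3.2 «`J_G(φ) ∈ I(U)`»].
[cite: Bouaziz1994IntegralesOrbitales, §3.2 p. 580] [cite: Shelstad1979, Thm. 4.7 (p. 31)] -/
theorem archHCSpaceG_orbFamG_iff (hα : ∀ i, α i ≠ 0) (hreal : ∀ (w : {w : InfinitePlace L // IsComplex w}) (k : Fin 3), (w.1.embedding (α k)).im = 0)
    {a' : ↥(arch (↥(maximalRealSubfield L)) L (IsCMField.complexConj L) 3 (Matrix.diagonal α)) → ℂ} (hc' : HasCompactSupport a') (jc' : Finset {w : InfinitePlace L // IsComplex w} → {w : InfinitePlace L // IsComplex w} → Fin 3 → Fin 3 → ℂ) :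
    ArchHCSpaceG (slotSign L α) jc' (orbFamG L α ν' a') ↔
      ArchHcSmoothOneSided (slotSign L α) (orbFamG L α ν' a') ∧ ArchHcJump (slotSign L α) jc' (orbFamG L α ν' a') :=
  ⟨fun h => ⟨h.2.2.1, h.2.2.2.2⟩,
    fun h => ⟨archHcPeriodic_orbFamG L α ν' a', archHcWeyl_orbFamG L α ν' hα hreal a', h.1, archHcCompactSupport_orbFamG L α ν' hc', h.2⟩⟩

/-- The letter-shaped corollary: from the two Harish-Chandra clauses to the full membership. [cite: Bouaziz1994IntegralesOrbitales, §3.2 p. 580] -/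
theorem archHCSpaceG_orbFamG (hα : ∀ i, α i ≠ 0) (hreal : ∀ (w : {w : InfinitePlace L // IsComplex w}) (k : Fin 3), (w.1.embedding (α k)).im = 0)
    {a' : ↥(arch (↥(maximalRealSubfield L)) L (IsCMField.complexConj L) 3 (Matrix.diagonal α)) → ℂ} (hc' : HasCompactSupport a') {jc' : Finset {w : InfinitePlace L // IsComplex w} → {w : InfinitePlace L // IsComplex w} → Fin 3 → Fin 3 → ℂ}
    (hI1 : ArchHcSmoothOneSided (slotSign L α) (orbFamG L α ν' a')) (hI3 : ArchHcJump (slotSign L α) jc' (orbFamG L α ν' a')) :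
    ArchHCSpaceG (slotSign L α) jc' (orbFamG L α ν' a') :=
  (archHCSpaceG_orbFamG_iff L α ν' hα hreal hc' jc').2 ⟨hI1, hI3⟩

end Residue

end Literature.NumberTheory.Rogawski1990

end
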